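import Summits.NavierStokesRegularity.NavierStokesRegularity.Theorems.ScenarioCensusRowA7stFlux

/-!
# Census rows A7st / A7uv — part 2/2: D1 drift constancy PROVED (KNSS-gauge: no uniform acceleration), compositions, closures; census keys

Re-homed for the scenario census (typer seat ns-census-typer-1 g5; lead g7 MINT INTENT addendum A7st 17:28Z [2/2], OFFER 17:30Z) from
ns-idea-2 g10/g11's LINE «strat-drift» REV 4 (`pub/ideators/ns-idea-2/lines/strat-drift/line-strat-drift.lean`, sha16 d45f1cf91f78b2fd, 530 l.,
SORRY-FREE; crit RE-STAMPs REV 2/3; lit §21.15 NOT IN PRINT), in two files for the 400-line rule: `ScenarioCensusRowA7stFlux` (§1–§3a: the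
cells `IsVertStratified` / `IsUniformVertical`, rows `Row_A7st` / `Row_A7uv`, lattice to A7h, F1 `FluxLemma` PROVED via `uniform_of_stratified`)
→ `ScenarioCensusRowA7st` (§3b–§4: D1 `DriftConstancy` / D1L `DriftConstancyL` PROVED via `meanDrift_holds` — KNSS 2009 §4 «the Oseen–Duhamel
term does not see constants», tree `OseenBallAverageMomentum` — compositions, `row_A7st_holds`, `row_A7uv_holds`; census keys).  Lean text
verbatim in namespace `…Theorems.ScenarioCensus.StratDrift` (the line's `…Lines.StratDrift` re-homed; `R3` notation spelled out; the `stub_*` aliases dropped (the (L′) bridge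
`row_A7st_of_typeIAncientLiouville` kept, lead 17:31Z); docstrings added where missing).

No census value is asserted here (the lead books A7st / A7uv); NS regularity is NOT proved; (L′), A1, A2 stay OPEN; no summit statement
is proved by this file.
-/

noncomputable section

set_option linter.unusedVariables false
set_option linter.style.longLine false
set_option linter.dupNamespace false

namespace Summit.NavierStokesRegularity.NavierStokesRegularity.Theorems.ScenarioCensus.StratDrift

open Set Function Filter Topology MeasureTheory
open scoped Interval
open Literature.Analysis Literature.Analysis.FluidPDE
open Summit.NavierStokesRegularity.NavierStokesRegularity
open Summit.NavierStokesRegularity.NavierStokesRegularity.Theorems.ScenarioCensus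
open Summit.NavierStokesRegularity.NavierStokesRegularity.Theorems.ScenarioCensus.HorizontalMeter (IsHorizontalValued)

/-- **D1 `DriftConstancy`** (obligation; the one analytic step, M-sized: Oseen-kernel bookkeeping / `BMO` pressure
normalisation): in the KNSS-gauge class a spatially uniform vertical velocity `w(t)` is constant in time, hence — by the
Type-I rate `|w(t)| ≤ C/√(−t) → 0` as `t → −∞` (`uniformVertical_zero_of_const` below) — ZERO: the field is
horizontal-valued.  Mechanism: third component of the Oseen mild identity, `w(t) − w(s) = −[B(u,u)]₃(x)` for all `x`, with
`[B(u,u)]₃ = Σ_{αβ} (∂₃∂_α∂_β Ψ_{t−τ}) ⋆ (u_αu_β)` after `div u = 0`, `∂₃w = 0`; its Gaussian means at scale `R` are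
`O(‖u‖²_∞ (t−s)/R)`, so the constant vanishes.  Why it might fail: the Oseen-tensor term must be shown to have
vanishing large-scale mean using only `u ∈ L^∞` (third derivatives of `E ⋆ φ_R` are `O(R⁻¹)` in `L¹` — fine), and the
tree's `oseenKernel` normalisation must match KNSS (1.3); a parasitic solution `u = (v(x − ∫w), w(t))` with accelerating
drift solves the PDE with pressure `−w′x₃` but is NOT Oseen-mild.  Sources: KNSS 2009 §4 (arXiv:0709.3599 p. 8, the
mild formulation fixes the pressure); Seregin, *Lecture notes on regularity theory for the NSE* (2014) Prop. 3.9;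
tree `Literature/Analysis/FluidPDE/AncientMildDrift.lean` (`isAncientMildSolution_timeConst`: in the DUALITY class
time-dependent constants ARE solutions — the KNSS-gauge Oseen identity is what excludes them). -/
def DriftConstancy : Prop :=
  ∀ (C : ℝ) (u : ℝ → (EuclideanSpace ℝ (Fin 3)) → (EuclideanSpace ℝ (Fin 3))), IsTypeIAncientMild C u → IsUniformVertical u →
    ∀ s t : ℝ, s < 0 → t < 0 → ∀ x y : (EuclideanSpace ℝ (Fin 3)), u s x 2 = u t y 2

/-- **D1L `DriftConstancyL`** (REV 3, critic N4 — the reusable typing of D1; THE remaining obligation): a spatially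
CONSTANT LINEAR COMPONENT `ℓ(u(t,·))` (`ℓ` any continuous linear functional on `(EuclideanSpace ℝ (Fin 3))`) of a KNSS-gauge Type-I ancient mild
field is TIME-INDEPENDENT («no uniform acceleration in the KNSS gauge»).  Same mechanism as D1 (apply `ℓ` to the Oseen
identity: `ℓ(u(t)) − ℓ(u(s)) = −ℓ(B(u,u))(x)` for every `x`; the Oseen kernel is a third derivative of a decaying potential,
so the large-scale means of the bounded function `ℓ(B(u,u))` are `O(1/R)` and the constant vanishes); the one-component
analogue of the tree's `IsTypeIAncientMild.const_eq_const_of_slice_const` (`KNSS2009_remark61`, FULLY slice-constant case).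
Why it might fail: only if the tree's `oseenKernel` normalisation were not mean-zero at large scales (it is the physical
one: `isTypeIAncientMild_iff`).  Sources: KNSS 2009 §4 and Remark 6.1 (arXiv:0709.3599 pp. 8, 11); Seregin 2014 pp. 109–113. -/
def DriftConstancyL : Prop :=
  ∀ (C : ℝ) (u : ℝ → (EuclideanSpace ℝ (Fin 3)) → (EuclideanSpace ℝ (Fin 3))), IsTypeIAncientMild C u → ∀ ℓ : (EuclideanSpace ℝ (Fin 3)) →L[ℝ] ℝ,
    (∀ t : ℝ, t < 0 → ∀ x y : (EuclideanSpace ℝ (Fin 3)), ℓ (u t x) = ℓ (u t y)) →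
    ∀ s t : ℝ, s < 0 → t < 0 → ∀ x y : (EuclideanSpace ℝ (Fin 3)), ℓ (u s x) = ℓ (u t y)

/-! ### REV 4 (g11): D1L PROVED — momentum is conserved at spatial infinity in the KNSS gauge

The tree file `Literature/Analysis/FluidPDE/OseenBallAverageMomentum.lean` (KNSS 2009 §4, «`B` does not see constants»)
proves that neither term of the Oseen integral equation moves the large-scale mean: for bounded measurable data
`⨍_{B_R} (e^{τΔ}g − g) → 0` (`tendsto_setAverage_heatExtension_sub`) and for a bounded jointly measurable field
`⨍_{B_R} B¹_s(V,V)(t) → 0` (`tendsto_setAverage_oseenDuhamel`) as `R → ∞`.  Hence (display `MeanDrift`, PROVED):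
for every KNSS-gauge Type-I ancient mild `u` and `s < t < 0`, `⨍_{B_R} (u(t) − u(s)) → 0` — «no uniform acceleration
at infinity».  Applying a continuous linear functional `ℓ` whose slices `ℓ ∘ u(t, ·)` are spatially constant turns the
vanishing mean into the constant `ℓ(u(t,0)) − ℓ(u(s,0))`, which is therefore `0`: this is D1L. -/

/-- The MEASURABLE MODIFICATION of a KNSS-gauge field: `u` on `t < 0`, `0` on `t ≥ 0` (the class only speaks about
`t < 0`; the Oseen–Duhamel term between negative times does not see the modification). -/
def pastField (u : ℝ → (EuclideanSpace ℝ (Fin 3)) → (EuclideanSpace ℝ (Fin 3))) : ℝ → (EuclideanSpace ℝ (Fin 3)) → (EuclideanSpace ℝ (Fin 3)) := fun σ z => if σ < 0 then u σ z else 0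

/-- `pastField u σ = u σ` for `σ < 0`. -/
theorem pastField_of_neg (u : ℝ → (EuclideanSpace ℝ (Fin 3)) → (EuclideanSpace ℝ (Fin 3))) {σ : ℝ} (hσ : σ < 0) : pastField u σ = u σ := by
  funext z; simp [pastField, hσ]

/-- The past field of a KNSS-gauge field is jointly measurable. -/
theorem measurable_uncurry_pastField {C : ℝ} {u : ℝ → (EuclideanSpace ℝ (Fin 3)) → (EuclideanSpace ℝ (Fin 3))} (hu : IsTypeIAncientMild C u) :
    Measurable (uncurry (pastField u)) := by
  classical
  have e : uncurry (pastField u) =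
      (Iio (0 : ℝ) ×ˢ (univ : Set (EuclideanSpace ℝ (Fin 3)))).piecewise (uncurry u) (fun _ => (0 : (EuclideanSpace ℝ (Fin 3)))) := by
    funext p
    rcases p with ⟨σ, z⟩
    by_cases hσ : σ < 0
    · rw [Set.piecewise_eq_of_mem _ _ _ (mk_mem_prod (mem_Iio.2 hσ) (mem_univ z))]
      simp [pastField, hσ]
    · rw [Set.piecewise_eq_of_notMem _ _ _ (fun h => hσ (mem_prod.1 h).1)]
      simp [pastField, hσ]
  rw [e]
  exact ContinuousOn.measurable_piecewise hu.continuousOn_uncurry continuousOn_const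
    (measurableSet_Iio.prod MeasurableSet.univ)

/-- The Oseen–Duhamel term between negative times does not see the modification. -/
theorem oseenDuhamel_pastField {C : ℝ} {u : ℝ → (EuclideanSpace ℝ (Fin 3)) → (EuclideanSpace ℝ (Fin 3))} (hu : IsTypeIAncientMild C u) {s t : ℝ}
    (ht : t < 0) (x : (EuclideanSpace ℝ (Fin 3))) :
    oseenDuhamel 1 s (pastField u) (pastField u) t x = oseenDuhamel 1 s u u t x := by
  simp only [oseenDuhamel]
  refine setIntegral_congr_fun measurableSet_Ioo (fun σ hσ => ?_)
  simp only [pastField_of_neg u (hσ.2.trans ht)]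

/-- **Display `MeanDrift`**: the large-scale mean of a KNSS-gauge Type-I ancient mild field does not move —
`⨍_{B_R} (u(t) − u(s)) → 0` as `R → ∞` for all `s < t < 0` (conservation of momentum at spatial infinity; KNSS 2009 §4:
the gauge excludes the parasitic solutions `b(t)`). -/
def MeanDrift : Prop :=
  ∀ (C : ℝ) (u : ℝ → (EuclideanSpace ℝ (Fin 3)) → (EuclideanSpace ℝ (Fin 3))), IsTypeIAncientMild C u → ∀ s t : ℝ, s < t → t < 0 →
    Tendsto (fun R : ℝ => ⨍ x in Metric.ball (0 : (EuclideanSpace ℝ (Fin 3))) R, (u t x - u s x)) atTop (𝓝 0)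

/-- The caloric increment and the Duhamel term along a KNSS-gauge field: continuity, integrability on balls, and the
mild identity in the form `u(t) − u(s) = (e^{(t−s)Δ}u(s) − u(s)) − B¹_s(u,u)(t)`. -/
theorem continuous_heatExtension_slice {C : ℝ} {u : ℝ → (EuclideanSpace ℝ (Fin 3)) → (EuclideanSpace ℝ (Fin 3))} (hu : IsTypeIAncientMild C u) {s t : ℝ}
    (hst : s < t) (hs : s < 0) :
    Continuous (UnboundedOperators.heatExtension (u s) (t - s)) :=
  (UnboundedOperators.contDiff_heatExtension_of_bound (F := (EuclideanSpace ℝ (Fin 3))) (hu.continuous_slice hs)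
    (fun z => hu.norm_le hs z) (sub_pos.2 hst) (m := 0)).continuous

/-- Slices of the Oseen–Duhamel term of a KNSS-gauge field are continuous. -/
theorem continuous_oseenDuhamel_slice {C : ℝ} {u : ℝ → (EuclideanSpace ℝ (Fin 3)) → (EuclideanSpace ℝ (Fin 3))} (hu : IsTypeIAncientMild C u) {s t : ℝ}
    (hst : s < t) (ht : t < 0) :
    Continuous (oseenDuhamel 1 s u u t) := by
  have hs : s < 0 := hst.trans ht
  have e : oseenDuhamel 1 s u u t = fun x => UnboundedOperators.heatExtension (u s) (t - s) x - u t x := by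
    funext x
    have h := hu.mild_eq_heatExtension hst ht x
    rw [h]; abel
  rw [e]
  exact (continuous_heatExtension_slice hu hst hs).sub (hu.continuous_slice ht)

/-- Continuous fields are integrable on balls. -/
theorem integrableOn_ball_of_continuous {f : (EuclideanSpace ℝ (Fin 3)) → (EuclideanSpace ℝ (Fin 3))} (hf : Continuous f) (R : ℝ) :
    IntegrableOn f (Metric.ball (0 : (EuclideanSpace ℝ (Fin 3))) R) :=
  (hf.continuousOn.integrableOn_compact (isCompact_closedBall (0 : (EuclideanSpace ℝ (Fin 3))) R)).mono_set
    Metric.ball_subset_closedBall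

/-- A continuous linear functional commutes with ball averages of a continuous field. -/
theorem clm_setAverage_ball (ℓ : (EuclideanSpace ℝ (Fin 3)) →L[ℝ] ℝ) {f : (EuclideanSpace ℝ (Fin 3)) → (EuclideanSpace ℝ (Fin 3))} (hf : Continuous f) (R : ℝ) :
    ℓ (⨍ x in Metric.ball (0 : (EuclideanSpace ℝ (Fin 3))) R, f x) = ⨍ x in Metric.ball (0 : (EuclideanSpace ℝ (Fin 3))) R, ℓ (f x) := by
  rw [setAverage_eq, setAverage_eq, map_smul,
    ← ContinuousLinearMap.integral_comp_comm ℓ (integrableOn_ball_of_continuous hf R)]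

/-- **`MeanDrift` PROVED** from the tree's momentum lemmas (`OseenBallAverageMomentum`). -/
theorem meanDrift_holds : MeanDrift := by
  have hE3 : Module.finrank ℝ (EuclideanSpace ℝ (Fin 3)) = 3 := by simp
  intro C u hu s t hst ht
  have hs : s < 0 := hst.trans ht
  -- the caloric increment
  have hH : Tendsto (fun R : ℝ => ⨍ x in Metric.ball (0 : (EuclideanSpace ℝ (Fin 3))) R,
      (UnboundedOperators.heatExtension (u s) (t - s) x - u s x)) atTop (𝓝 0) :=
    tendsto_setAverage_heatExtension_sub hE3 (hu.continuous_slice hs).measurable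
      (fun z => hu.norm_le hs z) (sub_pos.2 hst)
  -- the Duhamel term, through the measurable modification
  have hVN : ∀ σ ∈ Icc s t, ∀ z, ‖pastField u σ z‖ ≤ C / Real.sqrt (-t) := by
    intro σ hσ z
    have hσ0 : σ < 0 := lt_of_le_of_lt hσ.2 ht
    rw [pastField_of_neg u hσ0]
    refine (hu.norm_le hσ0 z).trans ?_
    exact div_le_div_of_nonneg_left hu.nonneg (Real.sqrt_pos.2 (by linarith))
      (Real.sqrt_le_sqrt (by linarith [hσ.2]))
  have hO' : Tendsto (fun R : ℝ => ⨍ x in Metric.ball (0 : (EuclideanSpace ℝ (Fin 3))) R,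
      oseenDuhamel 1 s (pastField u) (pastField u) t x) atTop (𝓝 0) :=
    tendsto_setAverage_oseenDuhamel hE3 (measurable_uncurry_pastField hu) hst hVN
  have hO : Tendsto (fun R : ℝ => ⨍ x in Metric.ball (0 : (EuclideanSpace ℝ (Fin 3))) R, oseenDuhamel 1 s u u t x)
      atTop (𝓝 0) := by
    refine hO'.congr' (Eventually.of_forall fun R => ?_)
    simp only [oseenDuhamel_pastField hu ht]
  -- the mild identity, averaged
  have hid : ∀ R : ℝ, (⨍ x in Metric.ball (0 : (EuclideanSpace ℝ (Fin 3))) R, (u t x - u s x)) =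
      (⨍ x in Metric.ball (0 : (EuclideanSpace ℝ (Fin 3))) R, (UnboundedOperators.heatExtension (u s) (t - s) x - u s x)) -
        ⨍ x in Metric.ball (0 : (EuclideanSpace ℝ (Fin 3))) R, oseenDuhamel 1 s u u t x := by
    intro R
    have hI1 : IntegrableOn (fun x => UnboundedOperators.heatExtension (u s) (t - s) x - u s x)
        (Metric.ball (0 : (EuclideanSpace ℝ (Fin 3))) R) :=
      integrableOn_ball_of_continuous ((continuous_heatExtension_slice hu hst hs).sub
        (hu.continuous_slice hs)) R
    have hI2 : IntegrableOn (oseenDuhamel 1 s u u t) (Metric.ball (0 : (EuclideanSpace ℝ (Fin 3))) R) :=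
      integrableOn_ball_of_continuous (continuous_oseenDuhamel_slice hu hst ht) R
    rw [setAverage_eq, setAverage_eq, setAverage_eq, ← smul_sub, ← integral_sub hI1 hI2]
    congr 1
    refine setIntegral_congr_fun Metric.isOpen_ball.measurableSet (fun x _ => ?_)
    have h := hu.mild_eq_heatExtension hst ht x
    rw [h]; abel
  have h := hH.sub hO
  rw [sub_zero] at h
  exact h.congr (fun R => (hid R).symm)

/-- **D1L PROVED** (`DriftConstancyL`): apply `ℓ` to `MeanDrift`; the averaged quantity is the constant
`ℓ(u(t,0)) − ℓ(u(s,0))`, so it vanishes. -/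
theorem driftConstancyL_holds : DriftConstancyL := by
  intro C u hu ℓ hℓ s t hs ht x y
  -- two-time statement at the origin
  suffices key : ∀ s t : ℝ, s < t → t < 0 → ℓ (u s 0) = ℓ (u t 0) by
    rcases lt_trichotomy s t with hst | rfl | hts
    · rw [hℓ s hs x 0, key s t hst ht, hℓ t ht 0 y]
    · exact hℓ s hs x y
    · rw [hℓ s hs x 0, ← key t s hts hs, hℓ t ht 0 y]
  intro s t hst ht
  have hs : s < 0 := hst.trans ht
  have hmean := meanDrift_holds C u hu s t hst ht
  -- `ℓ` of the ball average is the constant `ℓ(u t 0) − ℓ(u s 0)` for `R > 0`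
  have hcont : Continuous (fun x => u t x - u s x) := (hu.continuous_slice ht).sub (hu.continuous_slice hs)
  have hconst : ∀ R : ℝ, 0 < R →
      ℓ (⨍ x in Metric.ball (0 : (EuclideanSpace ℝ (Fin 3))) R, (u t x - u s x)) = ℓ (u t 0) - ℓ (u s 0) := by
    intro R hR
    rw [clm_setAverage_ball ℓ hcont R]
    have e : (fun x => ℓ (u t x - u s x)) = fun _ => ℓ (u t 0) - ℓ (u s 0) := by
      funext x; rw [map_sub, hℓ t ht x 0, hℓ s hs x 0]
    rw [e]
    exact setAverage_const (Metric.measure_ball_pos volume (0 : (EuclideanSpace ℝ (Fin 3))) hR).ne' measure_ball_lt_top.ne _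
  have hlim : Tendsto (fun R : ℝ => ℓ (⨍ x in Metric.ball (0 : (EuclideanSpace ℝ (Fin 3))) R, (u t x - u s x))) atTop (𝓝 0) := by
    have h := (ℓ.continuous.tendsto 0).comp hmean
    rw [map_zero] at h
    exact h
  have hlim' : Tendsto (fun _ : ℝ => ℓ (u t 0) - ℓ (u s 0)) atTop (𝓝 (0 : ℝ)) :=
    hlim.congr' (by
      filter_upwards [eventually_gt_atTop (0 : ℝ)] with R hR
      exact hconst R hR)
  have h0 : ℓ (u t 0) - ℓ (u s 0) = 0 := tendsto_nhds_unique tendsto_const_nhds hlim'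
  linarith

/-- **D1L ⇒ D1** (PROVED: take `ℓ = ` the third coordinate functional `EuclideanSpace.proj 2`). -/
theorem driftConstancy_of_L (hL : DriftConstancyL) : DriftConstancy := by
  intro C u hu hU s t hs ht x y
  have h := hL C u hu (EuclideanSpace.proj (𝕜 := ℝ) (2 : Fin 3)) (fun τ hτ a b => by
    simpa using hU τ hτ a b) s t hs ht x y
  simpa using h



/-- A time-constant uniform vertical component with the Type-I rate vanishes. -/
theorem uniformVertical_zero_of_const {C : ℝ} {u : ℝ → (EuclideanSpace ℝ (Fin 3)) → (EuclideanSpace ℝ (Fin 3))} (hu : IsTypeIAncientMild C u)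
    (hconst : ∀ s t : ℝ, s < 0 → t < 0 → ∀ x y : (EuclideanSpace ℝ (Fin 3)), u s x 2 = u t y 2) : IsHorizontalValued u := by
  intro s hs x
  -- `|u s x 2| = |u t x 2| ≤ ‖u t x‖ ≤ C/√(−t)` for every `t < 0`, and `C/√(−t) → 0` as `t → −∞`.
  have hbound : ∀ᶠ t in atBot, |u s x 2| ≤ C / Real.sqrt (-t) := by
    filter_upwards [eventually_lt_atBot (0 : ℝ)] with t ht
    rw [hconst s t hs ht x x]
    calc |u t x 2| = ‖u t x 2‖ := (Real.norm_eq_abs _).symm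
      _ ≤ ‖u t x‖ := PiLp.norm_apply_le (u t x) 2
      _ ≤ C / Real.sqrt (-t) := hu.norm_le ht x
  have hlim : Tendsto (fun t : ℝ => C / Real.sqrt (-t)) atBot (𝓝 0) :=
    (Real.tendsto_sqrt_atTop.comp tendsto_neg_atBot_atTop).const_div_atTop C
  have h0 : |u s x 2| ≤ 0 := ge_of_tendsto hlim hbound
  exact abs_eq_zero.1 (le_antisymm h0 (abs_nonneg _))

/-- **D1 ⇒ Row A7uv** (with A7h from the tree). -/
theorem row_A7uv_of_D1 (hD1 : DriftConstancy) : Row_A7uv := by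
  intro C u hu hv
  exact row_A7h_excluded C u hu (uniformVertical_zero_of_const hu (hD1 C u hu hv))

/-- **F1 + D1 ⇒ Row A7st** (with A7h from the tree). -/
theorem row_A7st_of_stubs (hF1 : FluxLemma) (hD1 : DriftConstancy) : Row_A7st := by
  intro C u hu hv
  exact row_A7uv_of_D1 hD1 C u hu (hF1 C u hu hv)

/-- **REV 2 composition: D1 ALONE ⇒ Row A7st** (F1 proved, A7h from the tree). -/
theorem row_A7st_of_D1 (hD1 : DriftConstancy) : Row_A7st :=
  row_A7st_of_stubs fluxLemma_holds hD1

/-- **REV 3 composition: D1L ALONE ⇒ Row A7st**. -/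
theorem row_A7st_of_D1L (hL : DriftConstancyL) : Row_A7st :=
  row_A7st_of_D1 (driftConstancy_of_L hL)

/-- REV 2: the two proposed rows are EQUIVALENT obligations-wise — both reduce to D1 (and `Row_A7st ⇒ Row_A7uv` is the lattice). -/
theorem row_A7st_iff_row_A7uv : Row_A7st ↔ Row_A7uv :=
  ⟨row_A7uv_of_row_A7st, fun h C u hu hv => h C u hu (fluxLemma_holds C u hu hv)⟩


/-! ## 5. REV 4: the rows, kernel-closed -/

/-- **Row A7st EXCLUDED (REV 4, sorry-free)**: a KNSS-gauge Type-I ancient mild solution whose vertical velocity is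
stratified (`u₃(t,x)` a function of `(t, x₃)` only) is identically zero. -/
theorem row_A7st_holds : Row_A7st := row_A7st_of_D1L driftConstancyL_holds

/-- **Row A7uv EXCLUDED (REV 4, sorry-free)**: uniform vertical drift ⇒ `u ≡ 0`. -/
theorem row_A7uv_holds : Row_A7uv := row_A7uv_of_row_A7st row_A7st_holds

end Summit.NavierStokesRegularity.NavierStokesRegularity.Theorems.ScenarioCensus.StratDrift

namespace Summit.NavierStokesRegularity.NavierStokesRegularity.Theorems.ScenarioCensus

/-- Census row A7st — (Type I in time, KNSS gauge `IsTypeIAncientMild C u`, any `C` · ancient · no symmetry; instead the VALUE constraint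
«STRATIFIED vertical velocity» `u₃(t,x) = w(t,x₃)` (`StratDrift.IsVertStratified`), `u_h` arbitrary and `x₃`-dependent): `u ≡ 0`,
BY NAME `StratDrift.Row_A7st` (ns-idea-2 LINE «strat-drift» REV 4, VERBATIM).  Closed by `row_A7st_excluded`; the census lead books the value. -/
def Row_A7st : Prop := StratDrift.Row_A7st

/-- A7st is PROVED in the tree: `StratDrift.row_A7st_holds` (F1 flux lemma + D1 drift constancy + row A7h).  No summit proved. -/
theorem row_A7st_excluded : Row_A7st := StratDrift.row_A7st_holds

/-- Census sub-row A7uv — (same class · UNIFORM vertical drift `u₃(t,·)` spatially constant): `u ≡ 0`, BY NAME `StratDrift.Row_A7uv`.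
Closed by `row_A7uv_excluded`. -/
def Row_A7uv : Prop := StratDrift.Row_A7uv

/-- A7uv is PROVED in the tree: `StratDrift.row_A7uv_holds`. -/
theorem row_A7uv_excluded : Row_A7uv := StratDrift.row_A7uv_holds

/-- `Row_A7st ↔ Row_A7uv` (F1 in kernel: `StratDrift.row_A7st_iff_row_A7uv`). -/
theorem row_A7st_iff_row_A7uv : Row_A7st ↔ Row_A7uv := StratDrift.row_A7st_iff_row_A7uv

/-- Lattice: A7uv ⇒ A7h (`StratDrift.row_A7h_of_row_A7uv`; `Row_A7h` = `HorizontalMeter.Row_A7h` BY NAME). -/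
theorem row_A7h_of_row_A7uv (h : Row_A7uv) : Row_A7h := StratDrift.row_A7h_of_row_A7uv h

end Summit.NavierStokesRegularity.NavierStokesRegularity.Theorems.ScenarioCensus

end
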